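import Mathlib.Data.Fintype.Perm
import Summits.ValiantsHypothesis.ValiantsHypothesis.Theorems.LacunarySymmetroidMatrixDescartesCensusTropicalKLaw
import Summits.ValiantsHypothesis.ValiantsHypothesis.Theorems.LacunarySymmetroidMatrixDescartesCensusTropicalKLawStatic

/-!
# Route «KPlusLogSqLaw», crux `TropicalB` — structure lemma: alternations versus PERMUTATION CHANGES

HONEST FRAMING.  Helper file for the crux `Summit.ValiantsHypothesis.ValiantsHypothesis.Theses.KPlusLogSqLaw.TropicalB`
(ledger item `stmt-ValiantsHypothesis-19771`; route `KPlusLogSqLaw`, object-search cell `pub-symmetroid`, seat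
val-sym-lift-p2, 2026-08-26), in the vocabulary of `…CensusTropicalKLaw` (`TropRootLawAt`, `IsDominant`, `termSign`,
`dRank`, `termRank`; `score_lt_of_dominant`, `present_of_termSign_ne_zero` of `…TropicalKLawStatic`).  It proves STRUCTURAL INEQUALITIES for dominant chains of a tropical design and nothing else:
no statement about `TropicalB`, `Lifting`, `KPlusLogSqLaw`, `MatrixDescartes` or `VP ≠ VNP` is asserted or assumed.

THE LEMMA.  Let `p₀, …, pₙ` (`pₖ = (σₖ, λₖ)`) be terms dominant at strictly increasing integer slopes `θ₀ < ⋯ < θₙ`,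
pairwise distinct (e.g. sign-alternating).  Then
* `d_lt_of_dominant_entry` — ENTRYWISE CLASS MONOTONICITY ACROSS PERMUTATIONS: if the same entry `(a, i)` is used at
  two chain positions `u < w` (`σᵤ i = σ_w i = a`, the permutations being otherwise arbitrary), its class is the same or
  has a strictly larger exponent at `w` (add the two strict optimality inequalities against the one-entry swaps; the
  tree's `d_lt_of_dominant` is the special case `σᵤ = σ_w`);
* `card_samePerm_steps_le` — the number of steps `k → k+1` with `σₖ₊₁ = σₖ` is at most `m²·(K−1)`: such a step raises the
  exponent rank of at least one entry, every entry's rank is monotone along its uses and lives in `[0, K−1]`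
  (injection `k ↦ (entry, new rank)`);
* `le_permChanges_add` — hence **`n ≤ #{k : σₖ₊₁ ≠ σₖ} + m²(K−1)`**: the «fast digit» (class switches at a fixed
  permutation) contributes ADDITIVELY at most `m²(K−1)` to any chain, and everything beyond is PERMUTATION CHANGES;
* `succ_le_card_perms_mul` — the thin law with `m!` replaced by the number `P` of distinct permutations occurring in the
  chain: `n + 1 ≤ P·(m(K−1)+1)`; `le_of_constPerm` — a chain on one permutation has `n ≤ m(K−1)`.

READING (located, not claimed).  For the cell's `K = 4` fork (`TropK4Law 2` versus a cubic family) a design family with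
`Θ(m³)` alternations must change its optimal permutation `Θ(m³)` times — the count of class switches is `≤ 3m²` in total;
and `TropKPlusLogSqLaw` is equivalent to the same budget for the number of permutation changes of dominant chains
(`m²(K−1) ≤ 2^(2(K + log₂² m))`).  In the explicit `K = 3` family SHIFT-THREE of the cell (`C(m+2,2) − 1` terms) the
permutation changes only `m − 1` times; its quadratic count is carried by class switches, which this lemma caps at
`2m²` for every `K = 3` design.
-/

set_option linter.dupNamespace false
set_option autoImplicit false

namespace Summit.ValiantsHypothesis.ValiantsHypothesis.Theorems.LacunarySymmetroidMatrixDescartes.TropicalCensus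

open Summit.ValiantsHypothesis.ValiantsHypothesis.Theorems.MatrixDescartes.Negative
open scoped BigOperators
open Finset

section PermChanges

variable {m K : ℕ}

/-- **Entrywise class monotonicity ACROSS permutations.**  If `(σa, μ)` is the unique optimum at slope `θa` and `(σb, ν)`
at a larger slope `θb`, and both use the same entry at position `i` (`σa i = σb i`), then at that entry the classes agree
or the exponent strictly increases.  (Swap the class at position `i` in each optimum for the other's class: both swapped
terms are present, and adding the two strict inequalities gives `(θb − θa)·(d (ν i) − d (μ i)) > 0`.)  The tree's
`d_lt_of_dominant` is the case `σa = σb`. [folklore] -/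
theorem d_lt_of_dominant_entry (d : Fin K → ℕ) (v ε : Fin m → Fin m → Fin K → ℤ) {θa θb : ℤ} (hab : θa < θb)
    (σa σb : Equiv.Perm (Fin m)) (μ ν : Fin m → Fin K) (ha : IsDominant d v ε θa (σa, μ))
    (hb : IsDominant d v ε θb (σb, ν)) (i : Fin m) (hσ : σa i = σb i) (hi : μ i ≠ ν i) :
    d (μ i) < d (ν i) := by
  have hεb : ε (σa i) i (ν i) ≠ 0 := by
    rw [hσ]; exact present_of_termSign_ne_zero ε (σb, ν) hb.1 i
  have hεa : ε (σb i) i (μ i) ≠ 0 := by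
    rw [← hσ]; exact present_of_termSign_ne_zero ε (σa, μ) ha.1 i
  -- per-entry strict optimality of each dominant term against the other's class (tree `score_lt_of_dominant`)
  have h1 := score_lt_of_dominant d v ε θa σa μ ha i (ν i) hεb (Ne.symm hi)
  have h2 := score_lt_of_dominant d v ε θb σb ν hb i (μ i) hεa hi
  rw [hσ] at h1
  -- add the two strict inequalities: (θb − θa) · (d ν i − d μ i) > 0
  have h3 : (θb - θa) * ((d (ν i) : ℤ) - d (μ i)) > 0 := by nlinarith
  have h4 : (0 : ℤ) < (d (ν i) : ℤ) - d (μ i) := by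
    by_contra hcon
    push Not at hcon
    have : (θb - θa) * ((d (ν i) : ℤ) - d (μ i)) ≤ 0 :=
      mul_nonpos_of_nonneg_of_nonpos (by linarith) hcon
    linarith
  exact_mod_cast (sub_pos.mp h4)

/-- rank form of `d_lt_of_dominant_entry` along a chain: if positions `u ≤ w` of a dominant chain use the same entry at
`i`, the exponent rank at that entry does not decrease. [folklore] -/
theorem dRank_le_of_chain_entry (d : Fin K → ℕ) (v ε : Fin m → Fin m → Fin K → ℤ) {n : ℕ}
    (θ : Fin (n + 1) → ℤ) (p : Fin (n + 1) → Equiv.Perm (Fin m) × (Fin m → Fin K)) (hθ : StrictMono θ)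
    (hdom : ∀ k, IsDominant d v ε (θ k) (p k)) {u w : Fin (n + 1)} (huw : u ≤ w) (i : Fin m)
    (hσ : (p u).1 i = (p w).1 i) : dRank d ((p u).2 i) ≤ dRank d ((p w).2 i) := by
  rcases huw.eq_or_lt with h | h
  · subst h; exact le_rfl
  · by_cases hi : (p u).2 i = (p w).2 i
    · rw [hi]
    · have hu : IsDominant d v ε (θ u) ((p u).1, (p u).2) := hdom u
      have hw : IsDominant d v ε (θ w) ((p w).1, (p w).2) := hdom w
      exact (dRank_lt_of_lt d (d_lt_of_dominant_entry d v ε (hθ h) _ _ _ _ hu hw i hσ hi)).le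

/-- **Class switches are additive.**  Along a dominant chain of pairwise distinct terms at strictly increasing slopes, the
number of steps `k → k+1` that keep the permutation (`σₖ₊₁ = σₖ`) is at most `m²·(K−1)`: such a step strictly raises the
exponent rank of some entry `(σₖ i, i)`, ranks are monotone along the uses of an entry (`dRank_le_of_chain_entry`) and lie
in `[0, K−1]`, so `k ↦ ((σₖ₊₁ i, i), new rank)` is injective into `(Fin m × Fin m) × [1, K−1]`. [folklore] -/
theorem card_samePerm_steps_le (d : Fin K → ℕ) (v ε : Fin m → Fin m → Fin K → ℤ) (n : ℕ)
    (θ : Fin (n + 1) → ℤ) (p : Fin (n + 1) → Equiv.Perm (Fin m) × (Fin m → Fin K)) (hθ : StrictMono θ)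
    (hdom : ∀ k, IsDominant d v ε (θ k) (p k)) (hinj : Function.Injective p) :
    (univ.filter fun k : Fin n => (p k.castSucc).1 = (p k.succ).1).card ≤ m * m * (K - 1) := by
  classical
  rcases Nat.eq_zero_or_pos m with hm | hm
  · -- no positions: all terms coincide, so the chain has one term and no steps
    subst hm
    have hn : n = 0 := by
      by_contra hn
      have hne : (⟨0, by omega⟩ : Fin (n + 1)) ≠ ⟨1, by omega⟩ := by simp
      apply hne
      apply hinj
      refine Prod.ext (Subsingleton.elim _ _) (funext fun i => i.elim0)
    subst hn
    simp
  haveI : Nonempty (Fin m) := ⟨⟨0, hm⟩⟩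
  set S := univ.filter fun k : Fin n => (p k.castSucc).1 = (p k.succ).1 with hS
  have hdiff : ∀ k ∈ S, ∃ i, (p k.castSucc).2 i ≠ (p k.succ).2 i := by
    intro k hk
    rw [hS, mem_filter] at hk
    by_contra h
    push Not at h
    have heq : p k.castSucc = p k.succ := Prod.ext hk.2 (funext h)
    exact (k.castSucc_lt_succ).ne (hinj heq)
  choose! pos hpos using hdiff
  -- the injection
  let f : Fin n → (Fin m × Fin m) × ℕ :=
    fun k => (((p k.succ).1 (pos k), pos k), dRank d ((p k.succ).2 (pos k)))
  -- a same-permutation step strictly raises the rank at the chosen position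
  have hstrict : ∀ k ∈ S, dRank d ((p k.castSucc).2 (pos k)) < dRank d ((p k.succ).2 (pos k)) := by
    intro k hk
    have hk' := hk
    rw [hS, mem_filter] at hk'
    have hu : IsDominant d v ε (θ k.castSucc) ((p k.castSucc).1, (p k.castSucc).2) := hdom _
    have hw : IsDominant d v ε (θ k.succ) ((p k.succ).1, (p k.succ).2) := hdom _
    exact dRank_lt_of_lt d (d_lt_of_dominant_entry d v ε (hθ k.castSucc_lt_succ) _ _ _ _ hu hw (pos k)
      (by rw [hk'.2]) (hpos k hk))
  have hmaps : ∀ k ∈ S, f k ∈ (univ : Finset (Fin m × Fin m)) ×ˢ Finset.Icc 1 (K - 1) := by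
    intro k hk
    simp only [f, mem_product, mem_univ, true_and, mem_Icc]
    exact ⟨Nat.one_le_of_lt (hstrict k hk), dRank_le d _⟩
  have hinjOn : Set.InjOn f S := by
    intro k₁ hk₁ k₂ hk₂ hf
    have hk₁' := hk₁
    have hk₂' := hk₂
    rw [mem_coe, hS, mem_filter] at hk₁' hk₂'
    simp only [f, Prod.mk.injEq] at hf
    obtain ⟨⟨hrow, hposEq⟩, hrank⟩ := hf
    by_contra hne
    rcases lt_or_gt_of_ne hne with hlt | hlt
    · -- k₁ < k₂: entry used at k₁.succ ≤ k₂.castSucc with rank r, then strictly raised to r at k₂.succ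
      have huw : (k₁.succ : Fin (n + 1)) ≤ k₂.castSucc := by
        rw [Fin.le_iff_val_le_val, Fin.val_succ, Fin.val_castSucc]; exact hlt
      have hσ' : (p k₁.succ).1 (pos k₂) = (p k₂.castSucc).1 (pos k₂) := by
        have h' := hrow
        rw [hposEq] at h'
        rw [hk₂'.2]
        exact h'
      have hle := dRank_le_of_chain_entry d v ε θ p hθ hdom huw (pos k₂) hσ'
      have hlt' := hstrict k₂ hk₂
      rw [hposEq] at hrank
      omega
    · have huw : (k₂.succ : Fin (n + 1)) ≤ k₁.castSucc := by
        rw [Fin.le_iff_val_le_val, Fin.val_succ, Fin.val_castSucc]; exact hlt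
      have hσ' : (p k₂.succ).1 (pos k₁) = (p k₁.castSucc).1 (pos k₁) := by
        have h' := hrow
        rw [← hposEq] at h'
        rw [hk₁'.2]
        exact h'.symm
      have hle := dRank_le_of_chain_entry d v ε θ p hθ hdom huw (pos k₁) hσ'
      have hlt' := hstrict k₁ hk₁
      rw [← hposEq] at hrank
      omega
  have hcard := card_le_card_of_injOn f hmaps hinjOn
  rw [card_product, card_univ, Fintype.card_prod, Fintype.card_fin, Nat.card_Icc] at hcard
  calc S.card ≤ m * m * (K - 1 + 1 - 1) := hcard
    _ = m * m * (K - 1) := by congr 1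

/-- **Alternations ≤ permutation changes + `m²(K−1)`.**  For every tropical design of format `(m, K)` and every chain of
unique optima at strictly increasing integer slopes with alternating signs (the hypothesis list of `TropRootLawAt`),
the length `n` is at most the number of steps that CHANGE the permutation plus `m²(K−1)`. [folklore] -/
theorem le_permChanges_add (d : Fin K → ℕ) (v ε : Fin m → Fin m → Fin K → ℤ) (n : ℕ)
    (θ : Fin (n + 1) → ℤ) (p : Fin (n + 1) → Equiv.Perm (Fin m) × (Fin m → Fin K)) (hθ : StrictMono θ)
    (hdom : ∀ k, IsDominant d v ε (θ k) (p k))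
    (halt : ∀ k : Fin n, termSign ε (p k.castSucc) * termSign ε (p k.succ) < 0) :
    n ≤ (univ.filter fun k : Fin n => (p k.castSucc).1 ≠ (p k.succ).1).card + m * m * (K - 1) := by
  classical
  have hinj : Function.Injective p := stub_dominantInjective m K d v ε n θ p hθ hdom halt
  have h1 := card_samePerm_steps_le d v ε n θ p hθ hdom hinj
  have h2 := card_filter_add_card_filter_not
    (s := (univ : Finset (Fin n))) (fun k : Fin n => (p k.castSucc).1 = (p k.succ).1)
  rw [card_univ, Fintype.card_fin] at h2
  have h3 : (univ.filter fun k : Fin n => (p k.castSucc).1 ≠ (p k.succ).1)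
      = univ.filter fun k : Fin n => ¬ (p k.castSucc).1 = (p k.succ).1 := rfl
  rw [h3]
  omega

/-- **Thin law per chain.**  A dominant sign-alternating chain that uses `P` distinct permutations has at most
`P·(m(K−1)+1)` terms (the tree's `tropRootLawAt_thin` is `P ≤ m!`): for a fixed permutation the class vectors of the
chain terms have strictly increasing total exponent rank `termRank ∈ [0, m(K−1)]`. [folklore] -/
theorem succ_le_card_perms_mul (d : Fin K → ℕ) (v ε : Fin m → Fin m → Fin K → ℤ) (n : ℕ)
    (θ : Fin (n + 1) → ℤ) (p : Fin (n + 1) → Equiv.Perm (Fin m) × (Fin m → Fin K)) (hθ : StrictMono θ)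
    (hdom : ∀ k, IsDominant d v ε (θ k) (p k))
    (halt : ∀ k : Fin n, termSign ε (p k.castSucc) * termSign ε (p k.succ) < 0) :
    n + 1 ≤ (univ.image fun k => (p k).1).card * (m * (K - 1) + 1) := by
  classical
  have hinj : Function.Injective p := stub_dominantInjective m K d v ε n θ p hθ hdom halt
  let f : Fin (n + 1) → Equiv.Perm (Fin m) × ℕ := fun k => ((p k).1, termRank d (p k))
  have hkey : ∀ a b : Fin (n + 1), a < b → (p a).1 = (p b).1 → termRank d (p a) < termRank d (p b) := by
    intro a b hab h1
    have hne : p a ≠ p b := fun h => (ne_of_lt hab) (hinj h)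
    have h2 : (p a).2 ≠ (p b).2 := fun h => hne (Prod.ext h1 h)
    obtain ⟨i, hi⟩ := Function.ne_iff.mp h2
    have hmono : ∀ j, dRank d ((p a).2 j) ≤ dRank d ((p b).2 j) :=
      fun j => dRank_le_of_chain_entry d v ε θ p hθ hdom hab.le j (by rw [h1])
    have hda : IsDominant d v ε (θ a) ((p a).1, (p a).2) := hdom a
    have hdb : IsDominant d v ε (θ b) ((p b).1, (p b).2) := hdom b
    have hstrict : dRank d ((p a).2 i) < dRank d ((p b).2 i) :=
      dRank_lt_of_lt d (d_lt_of_dominant_entry d v ε (hθ hab) _ _ _ _ hda hdb i (by rw [h1]) hi)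
    unfold termRank
    exact sum_lt_sum (fun j _ => hmono j) ⟨i, mem_univ _, hstrict⟩
  have hmaps : ∀ k ∈ (univ : Finset (Fin (n + 1))),
      f k ∈ (univ.image fun k => (p k).1) ×ˢ Finset.range (m * (K - 1) + 1) := by
    intro k _
    simp only [f, mem_product, mem_image, mem_univ, true_and, mem_range]
    exact ⟨⟨k, rfl⟩, Nat.lt_succ_of_le (termRank_le d (p k))⟩
  have hinjOn : Set.InjOn f (univ : Finset (Fin (n + 1))) := by
    intro a _ b _ hfab
    simp only [f, Prod.mk.injEq] at hfab
    obtain ⟨h1, h2⟩ := hfab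
    rcases lt_trichotomy a b with h | h | h
    · exact absurd h2 (ne_of_lt (hkey a b h h1))
    · exact h
    · exact absurd h2.symm (ne_of_lt (hkey b a h h1.symm))
  have hcard := card_le_card_of_injOn f hmaps hinjOn
  rwa [card_univ, Fintype.card_fin, card_product, card_range] at hcard

/-- a dominant sign-alternating chain that never changes its permutation has at most `m(K−1)` steps (e.g. designs
all of whose present terms share one permutation, such as diagonal designs). [folklore] -/
theorem le_of_constPerm (d : Fin K → ℕ) (v ε : Fin m → Fin m → Fin K → ℤ) (n : ℕ)
    (θ : Fin (n + 1) → ℤ) (p : Fin (n + 1) → Equiv.Perm (Fin m) × (Fin m → Fin K)) (hθ : StrictMono θ)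
    (hdom : ∀ k, IsDominant d v ε (θ k) (p k))
    (halt : ∀ k : Fin n, termSign ε (p k.castSucc) * termSign ε (p k.succ) < 0)
    (σ : Equiv.Perm (Fin m)) (hσ : ∀ k, (p k).1 = σ) : n ≤ m * (K - 1) := by
  classical
  have h := succ_le_card_perms_mul d v ε n θ p hθ hdom halt
  have himg : (univ.image fun k => (p k).1) = {σ} := by
    ext τ
    simp only [mem_image, mem_univ, true_and, mem_singleton]
    constructor
    · rintro ⟨k, rfl⟩; exact hσ k
    · rintro rfl; exact ⟨0, hσ 0⟩
  rw [himg, card_singleton, one_mul] at h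
  omega

end PermChanges

end Summit.ValiantsHypothesis.ValiantsHypothesis.Theorems.LacunarySymmetroidMatrixDescartes.TropicalCensus
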